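import Summits.KontsevichZagierPeriods.KontsevichZagierPeriods.Theses.HurwitzMicroSectors
import Summits.KontsevichZagierPeriods.KontsevichZagierPeriods.Theorems.HurwitzMicroSectorsNormalFormPrinciplePiBoxTransfer

/-! TTRL-lite variant V2200 of stmt-KontsevichZagierPeriods-3869

Variant V2200 = `stub_boxRigidity` with the left dimension frozen, `fix m := 2` (the right dimension
`m'` free). Verdict of the attempt seat: **open, and provably as hard as the parent** — this file is the
certificate, not a proof of the variant. For EVERY fixed `m₀` the one-sided specialisation
`BoxRigidityLeft m₀` is equivalent to the whole leaf `BoxRigidity` (`boxRigidityLeft_iff`; likewise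
`boxRigidityRight_iff` for `fix m' := m₀`): the zero representation on the `m₀`-box is box-rational of
value `0`, so the one-sided statement makes every box-rational representation of value `0` (any
dimension) a relation, and BoxVanishing is BoxRigidity (`boxRigidity_of_boxVanishing`, tree). Hence
`KontsevichZagierPeriods → V2200 → KZ.PiLocalKernel` (`stub_boxRigidity_var2200_of_statement`,
`piLocalKernel_of_stub_boxRigidity_var2200`): the variant sits between the Summit and Ayoub's localised
kernel conjecture (`@[conjecture]`, open), so it is neither provable nor refutable from the tree; the
programmatic moves `fix_nat:m=k` / `fix_nat:m'=k` of this stub never produce an easier statement.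
(Contrast: the TWO-sided instance `m, m' ≤ 1` is the theorem `boxRigidity_of_le_one`, by Baker.)
Source: M. Kontsevich, D. Zagier, *Periods* (2001), §1.2 Conjecture 1; J. Ayoub, EMS Newsl. 91 (2014),
Conj. 7. Pure proof file, no definitions. -/

-- `Summit.<Summit>.<Problem>` is the tree's mandated summit-side namespace (CONVENTIONS §2); for this
-- single-conjunct summit the two coincide, so the duplicate is deliberate.
set_option linter.dupNamespace false

noncomputable section

namespace Summit.KontsevichZagierPeriods.KontsevichZagierPeriods.Theorems

open MeasureTheory Set
open Literature.NumberTheory.Transcendental Literature.NumberTheory.Transcendental.KZ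
open Summit.KontsevichZagierPeriods.KontsevichZagierPeriods.Theses.HurwitzMicroSectors
open Summit.KontsevichZagierPeriods.HurwitzMicroSectors.NormalFormPrinciple.PiBox

/-! ## One frozen dimension is as strong as none -/

/-- **`BoxRigidityLeft m₀ ⇒ BoxVanishing` (all dimensions).** If every box-rational representation of
the fixed dimension `m₀` is KZ-equivalent to every box-rational representation (any dimension) of the
same value, then a box-rational representation of value `0` is a relation: compare it with the zero
representation on the `m₀`-box (box-rational, value `0`, itself a relation).
[cite: KontsevichZagier2001, §1.2 Conjecture 1] -/
theorem boxVanishing_of_boxRigidityLeft (m₀ : ℕ)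
    (hrig : ∀ (m' : ℕ) (N : IntegralRep m₀) (N' : IntegralRep m'),
      N.domain = {x | ∀ i, x i ∈ Set.Ioo (0:ℝ) 1} → N.IsRational →
      N'.domain = {x | ∀ i, x i ∈ Set.Ioo (0:ℝ) 1} → N'.IsRational →
      N.value = N'.value → Equivalent N N')
    {m : ℕ} (N : IntegralRep m) (hNd : N.domain = {x | ∀ i, x i ∈ Set.Ioo (0:ℝ) 1})
    (hNr : N.IsRational) (hv : N.value = 0) : of N ∈ relations := by
  obtain ⟨Z, hZd, hZi⟩ := exists_zeroRep (isSemialgebraic_box m₀)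
  have hZ : of Z ∈ relations := of_mem_relations_of_eqOn_zero Z (by simp [hZi, EqOn])
  have hZv : Z.value = 0 := by simp [IntegralRep.value, hZi]
  have hZr : Z.IsRational := ⟨0, 1, fun x _ => by simp, fun x _ => by simp [hZi]⟩
  have h : of Z - of N ∈ relations := hrig m Z N hZd hZr hNd hNr (by rw [hv, hZv])
  have := relations.sub_mem hZ h
  rwa [sub_sub_cancel] at this

/-- **`BoxRigidityRight m₀ ⇒ BoxVanishing` (all dimensions)**, the same with the right dimension frozen
(compare with the zero representation on the `m₀`-box from the other side).
[cite: KontsevichZagier2001, §1.2 Conjecture 1] -/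
theorem boxVanishing_of_boxRigidityRight (m₀ : ℕ)
    (hrig : ∀ (m : ℕ) (N : IntegralRep m) (N' : IntegralRep m₀),
      N.domain = {x | ∀ i, x i ∈ Set.Ioo (0:ℝ) 1} → N.IsRational →
      N'.domain = {x | ∀ i, x i ∈ Set.Ioo (0:ℝ) 1} → N'.IsRational →
      N.value = N'.value → Equivalent N N')
    {m : ℕ} (N : IntegralRep m) (hNd : N.domain = {x | ∀ i, x i ∈ Set.Ioo (0:ℝ) 1})
    (hNr : N.IsRational) (hv : N.value = 0) : of N ∈ relations := by
  obtain ⟨Z, hZd, hZi⟩ := exists_zeroRep (isSemialgebraic_box m₀)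
  have hZ : of Z ∈ relations := of_mem_relations_of_eqOn_zero Z (by simp [hZi, EqOn])
  have hZv : Z.value = 0 := by simp [IntegralRep.value, hZi]
  have hZr : Z.IsRational := ⟨0, 1, fun x _ => by simp, fun x _ => by simp [hZi]⟩
  have h : of N - of Z ∈ relations := hrig m N Z hNd hNr hZd hZr (by rw [hv, hZv])
  have := relations.add_mem h hZ
  rwa [sub_add_cancel] at this

/-- **`BoxRigidityLeft m₀ ⟺ BoxRigidity`** for every fixed left dimension `m₀`: the programmatic move
`fix_nat:m=k` of `stub_boxRigidity` never weakens the leaf (through BoxVanishing and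
`boxRigidity_of_boxVanishing`). [cite: KontsevichZagier2001, §1.2 Conjecture 1] -/
theorem boxRigidityLeft_iff (m₀ : ℕ) :
    (∀ (m' : ℕ) (N : IntegralRep m₀) (N' : IntegralRep m'),
      N.domain = {x | ∀ i, x i ∈ Set.Ioo (0:ℝ) 1} → N.IsRational →
      N'.domain = {x | ∀ i, x i ∈ Set.Ioo (0:ℝ) 1} → N'.IsRational →
      N.value = N'.value → Equivalent N N') ↔
    (∀ (m m' : ℕ) (N : IntegralRep m) (N' : IntegralRep m'),
      N.domain = {x | ∀ i, x i ∈ Set.Ioo (0:ℝ) 1} → N.IsRational →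
      N'.domain = {x | ∀ i, x i ∈ Set.Ioo (0:ℝ) 1} → N'.IsRational →
      N.value = N'.value → Equivalent N N') :=
  ⟨fun hrig => boxRigidity_of_boxVanishing fun _ N hNd hNr hv =>
      boxVanishing_of_boxRigidityLeft m₀ hrig N hNd hNr hv,
    fun h m' N N' => h m₀ m' N N'⟩

/-- **`BoxRigidityRight m₀ ⟺ BoxRigidity`** for every fixed right dimension `m₀` (the move
`fix_nat:m'=k`). [cite: KontsevichZagier2001, §1.2 Conjecture 1] -/
theorem boxRigidityRight_iff (m₀ : ℕ) :
    (∀ (m : ℕ) (N : IntegralRep m) (N' : IntegralRep m₀),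
      N.domain = {x | ∀ i, x i ∈ Set.Ioo (0:ℝ) 1} → N.IsRational →
      N'.domain = {x | ∀ i, x i ∈ Set.Ioo (0:ℝ) 1} → N'.IsRational →
      N.value = N'.value → Equivalent N N') ↔
    (∀ (m m' : ℕ) (N : IntegralRep m) (N' : IntegralRep m'),
      N.domain = {x | ∀ i, x i ∈ Set.Ioo (0:ℝ) 1} → N.IsRational →
      N'.domain = {x | ∀ i, x i ∈ Set.Ioo (0:ℝ) 1} → N'.IsRational →
      N.value = N'.value → Equivalent N N') :=
  ⟨fun hrig => boxRigidity_of_boxVanishing fun _ N hNd hNr hv =>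
      boxVanishing_of_boxRigidityRight m₀ hrig N hNd hNr hv,
    fun h m N N' => h m m₀ N N'⟩

/-! ## The variant V2200 itself: between the Summit and `KZ.PiLocalKernel` -/

/-- **V2200 ⟺ the parent leaf `BoxRigidity`** (instance `m₀ = 2` of `boxRigidityLeft_iff`).
[cite: KontsevichZagier2001, §1.2 Conjecture 1] -/
theorem stub_boxRigidity_var2200_iff_parent :
    (∀ (m' : ℕ) (N : IntegralRep 2) (N' : IntegralRep m'), N.domain = {x | ∀ i, x i ∈ Set.Ioo (0:ℝ) 1} → N.IsRational → N'.domain = {x | ∀ i, x i ∈ Set.Ioo (0:ℝ) 1} → N'.IsRational → N.value = N'.value → Equivalent N N') ↔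
    (∀ (m m' : ℕ) (N : IntegralRep m) (N' : IntegralRep m'), N.domain = {x | ∀ i, x i ∈ Set.Ioo (0:ℝ) 1} → N.IsRational → N'.domain = {x | ∀ i, x i ∈ Set.Ioo (0:ℝ) 1} → N'.IsRational → N.value = N'.value → Equivalent N N') :=
  boxRigidityLeft_iff 2

/-- **V2200 ⇒ `KZ.PiLocalKernel`** (Ayoub's localised kernel conjecture for this calculus — open): so a
proof of the variant would settle an open conjecture of the tree. [cite: Ayoub2014, Def. 6 and Conj. 7] -/
theorem piLocalKernel_of_stub_boxRigidity_var2200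
    (h : ∀ (m' : ℕ) (N : IntegralRep 2) (N' : IntegralRep m'), N.domain = {x | ∀ i, x i ∈ Set.Ioo (0:ℝ) 1} → N.IsRational → N'.domain = {x | ∀ i, x i ∈ Set.Ioo (0:ℝ) 1} → N'.IsRational → N.value = N'.value → Equivalent N N') :
    PiLocalKernel :=
  piLocalKernel_of_boxRigidity (stub_boxRigidity_var2200_iff_parent.1 h)

/-- **`KontsevichZagierPeriods ⇒ V2200`**: the variant is a special case of Conjecture 1 for the
tree's calculus — so a refutation of the variant would refute the Summit. [cite: KontsevichZagier2001, §1.2 Conjecture 1] -/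
theorem stub_boxRigidity_var2200_of_statement (h : _root_.KontsevichZagierPeriods) :
    ∀ (m' : ℕ) (N : IntegralRep 2) (N' : IntegralRep m'), N.domain = {x | ∀ i, x i ∈ Set.Ioo (0:ℝ) 1} → N.IsRational → N'.domain = {x | ∀ i, x i ∈ Set.Ioo (0:ℝ) 1} → N'.IsRational → N.value = N'.value → Equivalent N N' :=
  fun m' N N' => (leaves_of_statement h).1 2 m' N N'

/-- **Summit ⟺ V2200 ∧ PiCancellation** (from `statement_iff_leaves`): with `π`-cancellation the variant
is exactly what the Summit needs, no more and no less. [cite: KontsevichZagier2001, §1.2 Conjecture 1] -/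
theorem statement_iff_stub_boxRigidity_var2200_and_piCancellation :
    _root_.KontsevichZagierPeriods ↔
    ((∀ (m' : ℕ) (N : IntegralRep 2) (N' : IntegralRep m'), N.domain = {x | ∀ i, x i ∈ Set.Ioo (0:ℝ) 1} → N.IsRational → N'.domain = {x | ∀ i, x i ∈ Set.Ioo (0:ℝ) 1} → N'.IsRational → N.value = N'.value → Equivalent N N') ∧
      PiCancellation) := by
  rw [statement_iff_leaves, stub_boxRigidity_var2200_iff_parent]

end Summit.KontsevichZagierPeriods.KontsevichZagierPeriods.Theorems
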